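import Literature.AlgebraicGeometry.Motives.HodgeStructureIrreducibleIndexDvdEigenPieces
import HarnessLib

/-!
# A real embedding of a number field acting on a Hodge structure of EVEN weight `2m`: `h^{p,q}_σ = h^{q,p}_σ`,
# `dim_ℂ V_σ = 2·dim_ℂ(V_σ ∩ F^{m+1}) + h^{m,m}_σ`, so `dim_E V ≡ h^{m,m}_σ (mod 2)` — and `2[E:ℚ] ∣ dim_ℚ V` as soon as
# `V^{m,m} = 0` (Totaro 2015, proof of Thm. 3.1: «it would suffice to assume that `V^{w/2,w/2} = 0`»); with a CENTRAL `E` on an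
# irreducible structure the congruence holds modulo `2d`, `d` the index of `E_φ`

[topic AlgebraicGeometry/Motives]

Layer `Literature/AlgebraicGeometry/Motives`, namespace `Literature.AlgebraicGeometry.Motives.HodgeStructure`; lane
`lit-hodgefound` (Track 2 foundations library), prover seat `lit-hodgefound-p02`, generation 48, self-proposed row g48-#3 of
`run/shared/lean/pub/lit-hodgefound/SKELETON.md` (the even-weight companion announced as free pointer (f) at the close of
generation 47, now with a printed source). THEOREMS ONLY: no definition, no instance, no notation, no named fact (D-0026 net
debt `0`). Sequel of this seat's g47-#5 `HodgeStructureEndActionRealEmbeddingParity` (ODD weight `2m+1`: `conj V_σ = V_σ` for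
`σ` real, `V_σ = (V_σ ∩ F^{m+1}) ⊕ (V_σ ∩ conj F^{m+1})`, `dim_ℂ V_σ = 2·dim_ℂ(V_σ ∩ F^{m+1})`, `2[E:ℚ] ∣ dim_ℚ V`), of
`WeilTypeCM(Proofs)` (`A : EndAction H E`, `V_σ = ⨅ₑ Eig((ι e)_ℂ, σ e)`, `V^{p,q}_σ = A.eigenPiece σ p q`,
`complexConj_eigenPiece_holds : conj V^{p,q}_σ = V^{q,p}_{σ̄}`, `iInf_eigenspace_eq_inf_sup_inf`,
`finrank_iInf_eigenspace_mul_finrank : dim_ℂ V_σ · [E:ℚ] = dim_ℚ V`) and of g48-#2 `HodgeStructureIrreducibleIndexDvdEigenPieces`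
(for a CENTRAL `E` on an irreducible `H`: the index `d` of `E_φ` divides `dim_ℂ(V_σ ∩ F^p)` and `dim_ℂ V^{p,q}_σ`).

## The source, verbatim

B. Totaro, *Hodge structures of type `(n,0,…,0,n)`*, IMRN 2015 [Totaro2015HodgeStructuresN00N] (held `paper:arxiv-1402.3666`),
proof of Thm. 3.1, p0007: «Let `F₀` be the center of `L` […] and let `F` be the subfield of `F₀` fixed by complex conjugation
[…] Then `F` is totally real, and so `F ⊗_ℚ ℂ` is the product of copies of `ℂ` indexed by the embeddings `σ₁, …, σ_g : F ↪ ℝ`.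
Each summand `V^{b,c}` of `V ⊗_ℚ ℂ` is a module over `F ⊗_ℚ ℂ`. So `V^{b,c}` splits as a direct sum of complex linear subspaces
on which `F` acts by `σ₁, …, σ_g`, respectively. For any integers `b` and `c`, `V^{b,c}` is the complex conjugate of `V^{c,b}` in
`V ⊗_ℚ ℂ`. Let `x` be an element of `V^{b,c}` on which `L` acts by an embedding `σ_j`. Since each element `a` in `F` acts
`ℚ`-linearly on `V`, we have `a(x̄) = \overline{ax} = \overline{σ_j(a)x} = σ_j(a)x̄` for all `a` in `F`, where the last equality uses
that `σ_j(a)` is real. So each embedding `L ↪ ℝ` occurs with the same multiplicity in `V^{b,c}` as in `V^{c,b}`. Also, `V` is a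
free `F`-module, and so `V ⊗_ℚ ℂ` is a free `F ⊗_ℚ ℂ`-module. That is, each embedding `F ↪ ℝ` occurs the same number of times
in `V ⊗_ℚ ℂ`. We now make our assumption that `V` has weight `w` and Hodge numbers `(n,0,…,0,n)`. (To prove the following bound,
it would suffice to assume that `V^{w/2,w/2} = 0`.) Then the previous paragraph implies that each embedding `F ↪ ℝ` occurs the
same number of times in `V ⊗_ℚ ℂ ≅ ℂ^{2n}`, and this number is even. Therefore, `[F:ℚ]` divides `n`».

## What is proved (`H : HodgeStructure V n`, `A : EndAction H E`, `σ : E →+* ℂ`; in §2–§4 `σ` is REAL; `V` finite-dimensional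
## where dimensions occur)

* §1 ANY `σ`, EVEN weight `n = 2m`: `EndAction.iInf_eigenspace_eq_inf_F_sup_inf_complexConj_F_even`
  (`V_σ = (V_σ ∩ F^{m+1}) ⊔ (V_σ ∩ conj F^m)`, disjoint), **`EndAction.iInf_eigenspace_inf_complexConj_F_eq_sup_eigenPiece`**
  (`V_σ ∩ conj F^m = (V_σ ∩ conj F^{m+1}) ⊔ V^{m,m}_σ`, disjoint), hence **`EndAction.finrank_iInf_eigenspace_eq_add_add_even`**:
  `dim_ℂ V_σ = dim_ℂ(V_σ ∩ F^{m+1}) + dim_ℂ(V_σ ∩ conj F^{m+1}) + h^{m,m}_σ`.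
* §2 `σ` REAL, any weight: **`EndAction.finrank_eigenPiece_swap_of_isReal`** — «each embedding `L ↪ ℝ` occurs with the same
  multiplicity in `V^{b,c}` as in `V^{c,b}`»: `h^{p,q}_σ = h^{q,p}_σ`.
* §3 `σ` REAL, EVEN weight: **`EndAction.finrank_iInf_eigenspace_eq_two_mul_add_of_isReal`** (`dim_ℂ V_σ = 2·dim_ℂ(V_σ ∩ F^{m+1}) +
  h^{m,m}_σ`), `EndAction.finrank_div_eq_two_mul_add_of_isReal` (`dim_E V = dim_ℚ V/[E:ℚ] = 2·dim_ℂ(V_σ ∩ F^{m+1}) + h^{m,m}_σ`),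
  **`EndAction.even_finrank_div_iff_even_finrank_eigenPiece_middle_of_isReal`** (`dim_E V ≡ h^{m,m}_σ (mod 2)` for EVERY real `σ` —
  so the middle blocks `h^{m,m}_σ` at the real places all have the parity of `dim_E V`), and Totaro's bound with its printed hypothesis:
  **`EndAction.two_mul_finrank_dvd_finrank_of_isReal_of_piece_eq_bot`** (`V^{m,m} = 0 ⟹ 2[E:ℚ] ∣ dim_ℚ V`),
  `EndAction.two_mul_finrank_dvd_finrank_of_isReal_of_forall_piece_eq_bot` (BOTH parities of the weight at once: «it would suffice
  to assume that `V^{w/2,w/2} = 0`», vacuous in odd weight), the totally real / odd-degree forms, and the `E_φ`-level reading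
  `two_mul_finrank_dvd_finrank_of_ringHom_endAlg_of_isReal_of_forall_piece_eq_bot` (`f : K → E_φ` with a real place).
* §4 WITH THE INDEX (irreducible `H`, `E` central, `hd : [E_φ:ℚ] = [Z:ℚ]·d²`): `d ∣ dim_ℂ(V_σ ∩ F^{m+1})` and `d ∣ h^{m,m}_σ` (g48-#2)
  give **`IsIrreducible.finrank_div_modEq_finrank_eigenPiece_middle_of_central_of_isReal`** (`dim_E V ≡ h^{m,m}_σ (mod 2d)`) and
  **`IsIrreducible.two_mul_index_mul_finrank_dvd_finrank_of_central_of_isReal_of_forall_piece_eq_bot`** (`V^{w/2,w/2} = 0 ⟹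
  2·d·[E:ℚ] ∣ dim_ℚ V`, either parity of `w`).

Honest column: only the first paragraph of Totaro's proof is formalised (the multiplicity bookkeeping at real places); the
classification part of Thm. 3.1 (which division algebras occur, the exceptional cases) is not touched. No polarization is used.
-/

noncomputable section

open Module NumberField
open scoped TensorProduct

universe u v

namespace Literature.AlgebraicGeometry.Motives.HodgeStructure

variable {V : Type u} [AddCommGroup V] [Module ℚ V] {n : ℤ} {H : HodgeStructure V n}
variable {E : Type v} [Field E] [NumberField E]

namespace EndAction

variable (A : EndAction H E)

/-! ## §1 Even weight `n = 2m`, any embedding: `V_σ = (V_σ ∩ F^{m+1}) ⊕ V^{m,m}_σ ⊕ (V_σ ∩ conj F^{m+1})` in dimensions -/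

/-- `n = 2m` ⟹ `V_σ = (V_σ ∩ F^{m+1}) ⊔ (V_σ ∩ conj F^m)` (`V_ℂ = F^{m+1} ⊕ conj F^m`, both stable under the action).
[cite: Totaro2015HodgeStructuresN00N, §3 proof of Thm. 3.1 (arXiv p0007) «V^{b,c} splits as a direct sum of complex linear subspaces on which F acts by σ₁,…,σ_g»] -/
theorem iInf_eigenspace_eq_inf_F_sup_inf_complexConj_F_even {m : ℤ} (hm : n = 2 * m) (σ : E →+* ℂ) :
    (⨅ e, Module.End.eigenspace ((A.ι e).baseChange ℂ) (σ e)) =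
      (⨅ e, Module.End.eigenspace ((A.ι e).baseChange ℂ) (σ e)) ⊓ H.F (m + 1) ⊔
        (⨅ e, Module.End.eigenspace ((A.ι e).baseChange ℂ) (σ e)) ⊓ complexConj (H.F m) :=
  A.iInf_eigenspace_eq_inf_sup_inf σ (H.isCompl_F_complexConj (m + 1) m (by rw [hm]; ring))
    (fun e _ hx ↦ A.baseChange_mem_F e hx) (fun e _ hx ↦ A.baseChange_mem_complexConj_F e hx)

/-- The two summands are disjoint (`F^{m+1} ∩ conj F^m = 0`). [cite: Totaro2015HodgeStructuresN00N, §3 proof of Thm. 3.1 (arXiv p0007)] -/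
theorem disjoint_iInf_eigenspace_inf_F_inf_complexConj_F_even {m : ℤ} (hm : n = 2 * m) (σ : E →+* ℂ) :
    Disjoint ((⨅ e, Module.End.eigenspace ((A.ι e).baseChange ℂ) (σ e)) ⊓ H.F (m + 1))
      ((⨅ e, Module.End.eigenspace ((A.ι e).baseChange ℂ) (σ e)) ⊓ complexConj (H.F m)) :=
  (H.isCompl_F_complexConj (m + 1) m (by rw [hm]; ring)).disjoint.mono inf_le_right inf_le_right

/-- **`n = 2m` ⟹ `V_σ ∩ conj F^m = (V_σ ∩ conj F^{m+1}) ⊔ V^{m,m}_σ`**: split `x ∈ V_σ ∩ conj F^m` along `V_ℂ = F^m ⊕ conj F^{m+1}`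
inside `V_σ`; the `F^m`-component lies in `F^m ∩ conj F^m = V^{m,m}`. [cite: Totaro2015HodgeStructuresN00N, §3 proof of Thm. 3.1 (arXiv p0007)]
[cite: Deligne1982HodgeCycles, §4 (p. 30, «H¹_{B,σ} = H^{1,0}_σ ⊕ H^{0,1}_σ»)] -/
theorem iInf_eigenspace_inf_complexConj_F_eq_sup_eigenPiece {m : ℤ} (hm : n = 2 * m) (σ : E →+* ℂ) :
    (⨅ e, Module.End.eigenspace ((A.ι e).baseChange ℂ) (σ e)) ⊓ complexConj (H.F m) =
      (⨅ e, Module.End.eigenspace ((A.ι e).baseChange ℂ) (σ e)) ⊓ complexConj (H.F (m + 1)) ⊔ A.eigenPiece σ m m := by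
  set W := ⨅ e, Module.End.eigenspace ((A.ι e).baseChange ℂ) (σ e) with hW
  have hmm : m + m = n := by rw [hm]; ring
  have hanti : complexConj (H.F (m + 1)) ≤ complexConj (H.F m) :=
    complexConj_mono (H.antitone_F (by omega))
  refine le_antisymm (fun x hx ↦ ?_) (sup_le (inf_le_inf_left _ hanti) ?_)
  · -- split `x` along `V_ℂ = F^m ⊕ conj F^{m+1}` inside `V_σ`
    have hsplit := A.iInf_eigenspace_eq_inf_sup_inf σ (H.isCompl_F_complexConj m (m + 1) (by rw [hm]; ring))
      (fun e _ hx ↦ A.baseChange_mem_F e hx) (fun e _ hx ↦ A.baseChange_mem_complexConj_F e hx)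
    have hxW : x ∈ W := hx.1
    rw [hW, hsplit] at hxW
    obtain ⟨y, hy, z, hz, rfl⟩ := Submodule.mem_sup.1 hxW
    have hyconj : y ∈ complexConj (H.F m) := by
      have h := Submodule.sub_mem _ hx.2 (hanti hz.2)
      rwa [add_sub_cancel_right] at h
    refine Submodule.add_mem _ (Submodule.mem_sup_right ?_) (Submodule.mem_sup_left hz)
    exact ⟨(H.mem_piece_iff hmm).2 ⟨hy.2, by rw [← mem_complexConj]; exact hyconj⟩, hy.1⟩
  · rintro x ⟨hxp, hxW⟩
    exact ⟨hxW, H.piece_le_complexConj_F m m hxp⟩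

/-- The two summands of `V_σ ∩ conj F^m` are disjoint (`V^{m,m} ⊆ F^m` and `F^m ∩ conj F^{m+1} = 0`).
[cite: Totaro2015HodgeStructuresN00N, §3 proof of Thm. 3.1 (arXiv p0007)] -/
theorem disjoint_iInf_eigenspace_inf_complexConj_F_eigenPiece {m : ℤ} (hm : n = 2 * m) (σ : E →+* ℂ) :
    Disjoint ((⨅ e, Module.End.eigenspace ((A.ι e).baseChange ℂ) (σ e)) ⊓ complexConj (H.F (m + 1))) (A.eigenPiece σ m m) :=
  ((H.isCompl_F_complexConj m (m + 1) (by rw [hm]; ring)).disjoint.symm).mono inf_le_right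
    ((A.eigenPiece_le_piece σ m m).trans (H.piece_le_F m m))

variable [Module.Finite ℚ V]

/-- `n = 2m` ⟹ `dim_ℂ V_σ = dim_ℂ(V_σ ∩ F^{m+1}) + dim_ℂ(V_σ ∩ conj F^m)`. [cite: Totaro2015HodgeStructuresN00N, §3 proof of Thm. 3.1 (arXiv p0007)] -/
theorem finrank_iInf_eigenspace_eq_add_even {m : ℤ} (hm : n = 2 * m) (σ : E →+* ℂ) :
    finrank ℂ ↥(⨅ e, Module.End.eigenspace ((A.ι e).baseChange ℂ) (σ e)) =
      finrank ℂ ↥((⨅ e, Module.End.eigenspace ((A.ι e).baseChange ℂ) (σ e)) ⊓ H.F (m + 1)) +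
        finrank ℂ ↥((⨅ e, Module.End.eigenspace ((A.ι e).baseChange ℂ) (σ e)) ⊓ complexConj (H.F m)) := by
  have hdim := Submodule.finrank_sup_add_finrank_inf_eq
    ((⨅ e, Module.End.eigenspace ((A.ι e).baseChange ℂ) (σ e)) ⊓ H.F (m + 1))
    ((⨅ e, Module.End.eigenspace ((A.ι e).baseChange ℂ) (σ e)) ⊓ complexConj (H.F m))
  rw [(A.disjoint_iInf_eigenspace_inf_F_inf_complexConj_F_even hm σ).eq_bot, finrank_bot, add_zero,
    ← A.iInf_eigenspace_eq_inf_F_sup_inf_complexConj_F_even hm σ] at hdim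
  exact hdim

/-- `n = 2m` ⟹ `dim_ℂ(V_σ ∩ conj F^m) = dim_ℂ(V_σ ∩ conj F^{m+1}) + h^{m,m}_σ`. [cite: Totaro2015HodgeStructuresN00N, §3 proof of Thm. 3.1 (arXiv p0007)] -/
theorem finrank_iInf_eigenspace_inf_complexConj_F_eq_add {m : ℤ} (hm : n = 2 * m) (σ : E →+* ℂ) :
    finrank ℂ ↥((⨅ e, Module.End.eigenspace ((A.ι e).baseChange ℂ) (σ e)) ⊓ complexConj (H.F m)) =
      finrank ℂ ↥((⨅ e, Module.End.eigenspace ((A.ι e).baseChange ℂ) (σ e)) ⊓ complexConj (H.F (m + 1))) +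
        finrank ℂ (A.eigenPiece σ m m) := by
  have hdim := Submodule.finrank_sup_add_finrank_inf_eq
    ((⨅ e, Module.End.eigenspace ((A.ι e).baseChange ℂ) (σ e)) ⊓ complexConj (H.F (m + 1))) (A.eigenPiece σ m m)
  rw [(A.disjoint_iInf_eigenspace_inf_complexConj_F_eigenPiece hm σ).eq_bot, finrank_bot, add_zero,
    ← A.iInf_eigenspace_inf_complexConj_F_eq_sup_eigenPiece hm σ] at hdim
  exact hdim

/-- **`n = 2m`, any `σ`: `dim_ℂ V_σ = dim_ℂ(V_σ ∩ F^{m+1}) + dim_ℂ(V_σ ∩ conj F^{m+1}) + h^{m,m}_σ`.**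
[cite: Totaro2015HodgeStructuresN00N, §3 proof of Thm. 3.1 (arXiv p0007)] -/
theorem finrank_iInf_eigenspace_eq_add_add_even {m : ℤ} (hm : n = 2 * m) (σ : E →+* ℂ) :
    finrank ℂ ↥(⨅ e, Module.End.eigenspace ((A.ι e).baseChange ℂ) (σ e)) =
      finrank ℂ ↥((⨅ e, Module.End.eigenspace ((A.ι e).baseChange ℂ) (σ e)) ⊓ H.F (m + 1)) +
        finrank ℂ ↥((⨅ e, Module.End.eigenspace ((A.ι e).baseChange ℂ) (σ e)) ⊓ complexConj (H.F (m + 1))) +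
          finrank ℂ (A.eigenPiece σ m m) := by
  rw [A.finrank_iInf_eigenspace_eq_add_even hm σ, A.finrank_iInf_eigenspace_inf_complexConj_F_eq_add hm σ, add_assoc]

/-! ## §2 A real embedding occurs with the same multiplicity in `V^{p,q}` as in `V^{q,p}` -/

omit [Module.Finite ℚ V] in
/-- **«each embedding `L ↪ ℝ` occurs with the same multiplicity in `V^{b,c}` as in `V^{c,b}`»: `h^{p,q}_σ = h^{q,p}_σ` for `σ`
REAL** (`conj V^{p,q}_σ = V^{q,p}_{σ̄} = V^{q,p}_σ` and `conj` preserves dimensions). [cite: Totaro2015HodgeStructuresN00N, §3 proof of Thm. 3.1 (arXiv p0007)] -/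
theorem finrank_eigenPiece_swap_of_isReal {σ : E →+* ℂ} (hσ : ComplexEmbedding.IsReal σ) (p q : ℤ) :
    finrank ℂ (A.eigenPiece σ q p) = finrank ℂ (A.eigenPiece σ p q) := by
  have h := complexConj_eigenPiece_holds A σ p q
  rw [ComplexEmbedding.isReal_iff.1 hσ] at h
  rw [← h, finrank_complexConj]

omit [Module.Finite ℚ V] in
/-- `conj V^{p,q}_σ = V^{q,p}_σ` for `σ` real. [cite: Totaro2015HodgeStructuresN00N, §3 proof of Thm. 3.1 (arXiv p0007) «a(x̄) = σ_j(a) x̄»] -/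
theorem complexConj_eigenPiece_of_isReal {σ : E →+* ℂ} (hσ : ComplexEmbedding.IsReal σ) (p q : ℤ) :
    complexConj (A.eigenPiece σ p q) = A.eigenPiece σ q p := by
  rw [complexConj_eigenPiece_holds A σ p q, ComplexEmbedding.isReal_iff.1 hσ]

/-! ## §3 A real embedding in even weight: `dim_ℂ V_σ = 2·dim_ℂ(V_σ ∩ F^{m+1}) + h^{m,m}_σ` -/

/-- **`dim_ℂ V_σ = 2·dim_ℂ(V_σ ∩ F^{m+1}) + h^{m,m}_σ` for `σ` REAL and `n = 2m`.** [cite: Totaro2015HodgeStructuresN00N, §3 proof of Thm. 3.1 (arXiv p0007)] -/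
theorem finrank_iInf_eigenspace_eq_two_mul_add_of_isReal {m : ℤ} (hm : n = 2 * m) {σ : E →+* ℂ}
    (hσ : ComplexEmbedding.IsReal σ) :
    finrank ℂ ↥(⨅ e, Module.End.eigenspace ((A.ι e).baseChange ℂ) (σ e)) =
      2 * finrank ℂ ↥((⨅ e, Module.End.eigenspace ((A.ι e).baseChange ℂ) (σ e)) ⊓ H.F (m + 1)) +
        finrank ℂ (A.eigenPiece σ m m) := by
  rw [A.finrank_iInf_eigenspace_eq_add_add_even hm σ, A.finrank_iInf_eigenspace_inf_complexConj_F_of_isReal hσ (m + 1), two_mul]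

/-- **`dim_E V = dim_ℚ V/[E:ℚ] = 2·dim_ℂ(V_σ ∩ F^{m+1}) + h^{m,m}_σ`** for `σ` real, `n = 2m` (`dim_ℂ V_σ = dim_E V` for every `σ`:
«each embedding `F ↪ ℝ` occurs the same number of times in `V ⊗_ℚ ℂ`»). [cite: Totaro2015HodgeStructuresN00N, §3 proof of Thm. 3.1 (arXiv p0007)] -/
theorem finrank_div_eq_two_mul_add_of_isReal {m : ℤ} (hm : n = 2 * m) {σ : E →+* ℂ} (hσ : ComplexEmbedding.IsReal σ) :
    finrank ℚ V / finrank ℚ E =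
      2 * finrank ℂ ↥((⨅ e, Module.End.eigenspace ((A.ι e).baseChange ℂ) (σ e)) ⊓ H.F (m + 1)) +
        finrank ℂ (A.eigenPiece σ m m) := by
  rw [Nat.div_eq_of_eq_mul_left (Module.finrank_pos (R := ℚ) (M := E)) (A.finrank_iInf_eigenspace_mul_finrank σ).symm]
  exact A.finrank_iInf_eigenspace_eq_two_mul_add_of_isReal hm hσ

/-- **PARITY: `dim_E V ≡ h^{m,m}_σ (mod 2)` for every REAL embedding `σ` in even weight `2m`** — the middle blocks at the real
places all have the parity of `dim_E V`. [cite: Totaro2015HodgeStructuresN00N, §3 proof of Thm. 3.1 (arXiv p0007) «this number is even»] -/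
theorem finrank_div_modEq_finrank_eigenPiece_middle_of_isReal {m : ℤ} (hm : n = 2 * m) {σ : E →+* ℂ}
    (hσ : ComplexEmbedding.IsReal σ) : finrank ℚ V / finrank ℚ E ≡ finrank ℂ (A.eigenPiece σ m m) [MOD 2] := by
  unfold Nat.ModEq
  rw [A.finrank_div_eq_two_mul_add_of_isReal hm hσ, Nat.add_mod, Nat.mul_mod_right, zero_add, Nat.mod_mod]

/-- `dim_E V` is even iff `h^{m,m}_σ` is even, for each real `σ` in even weight `2m`. [cite: Totaro2015HodgeStructuresN00N, §3 proof of Thm. 3.1 (arXiv p0007)] -/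
theorem even_finrank_div_iff_even_finrank_eigenPiece_middle_of_isReal {m : ℤ} (hm : n = 2 * m) {σ : E →+* ℂ}
    (hσ : ComplexEmbedding.IsReal σ) : Even (finrank ℚ V / finrank ℚ E) ↔ Even (finrank ℂ (A.eigenPiece σ m m)) := by
  rw [A.finrank_div_eq_two_mul_add_of_isReal hm hσ, Nat.even_add, Nat.even_mul]
  simp

include A in
/-- **TOTARO'S BOUND WITH ITS PRINTED HYPOTHESIS: `V^{m,m} = 0` and `E` with a REAL embedding `σ` ⟹ `2[E:ℚ] ∣ dim_ℚ V`** in even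
weight `2m` («To prove the following bound, it would suffice to assume that `V^{w/2,w/2} = 0` … each embedding `F ↪ ℝ` occurs the
same number of times in `V ⊗_ℚ ℂ`, and this number is even. Therefore, `[F:ℚ]` divides `n`», `2n = dim_ℚ V`).
[cite: Totaro2015HodgeStructuresN00N, §3 Thm. 3.1 and proof (arXiv p0006–p0007)] -/
theorem two_mul_finrank_dvd_finrank_of_isReal_of_piece_eq_bot {m : ℤ} (hm : n = 2 * m) {σ : E →+* ℂ}
    (hσ : ComplexEmbedding.IsReal σ) (h0 : H.piece m m = ⊥) : 2 * finrank ℚ E ∣ finrank ℚ V := by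
  have hpiece : A.eigenPiece σ m m = ⊥ := eq_bot_iff.2 (h0 ▸ A.eigenPiece_le_piece σ m m)
  have h := A.finrank_iInf_eigenspace_eq_two_mul_add_of_isReal hm hσ
  rw [hpiece, finrank_bot, add_zero] at h
  refine ⟨finrank ℂ ↥((⨅ e, Module.End.eigenspace ((A.ι e).baseChange ℂ) (σ e)) ⊓ H.F (m + 1)), ?_⟩
  rw [← A.finrank_iInf_eigenspace_mul_finrank σ, h]
  ring

/-- `V^{m,m} = 0`, `σ` real, `n = 2m` ⟹ `dim_ℂ(V_σ ∩ F^{m+1}) · [E:ℚ] · 2 = dim_ℚ V` (the block count behind the bound).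
[cite: Totaro2015HodgeStructuresN00N, §3 proof of Thm. 3.1 (arXiv p0007)] -/
theorem two_mul_finrank_iInf_eigenspace_inf_F_mul_finrank_of_isReal_of_piece_eq_bot {m : ℤ} (hm : n = 2 * m) {σ : E →+* ℂ}
    (hσ : ComplexEmbedding.IsReal σ) (h0 : H.piece m m = ⊥) :
    2 * finrank ℂ ↥((⨅ e, Module.End.eigenspace ((A.ι e).baseChange ℂ) (σ e)) ⊓ H.F (m + 1)) * finrank ℚ E = finrank ℚ V := by
  have hpiece : A.eigenPiece σ m m = ⊥ := eq_bot_iff.2 (h0 ▸ A.eigenPiece_le_piece σ m m)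
  have h := A.finrank_iInf_eigenspace_eq_two_mul_add_of_isReal hm hσ
  rw [hpiece, finrank_bot, add_zero] at h
  rw [← h, A.finrank_iInf_eigenspace_mul_finrank σ]

include A in
/-- **Both parities of the weight at once: if `V^{k,k} = 0` whenever `2k = n` (vacuous for odd `n`), a real embedding forces
`2[E:ℚ] ∣ dim_ℚ V`** («it would suffice to assume that `V^{w/2,w/2} = 0`»; odd weight is g47-#5's `two_mul_finrank_dvd_finrank_of_isReal`).
[cite: Totaro2015HodgeStructuresN00N, §3 Thm. 3.1 and proof (arXiv p0006–p0007)] -/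
theorem two_mul_finrank_dvd_finrank_of_isReal_of_forall_piece_eq_bot (h0 : ∀ k : ℤ, n = 2 * k → H.piece k k = ⊥) {σ : E →+* ℂ}
    (hσ : ComplexEmbedding.IsReal σ) : 2 * finrank ℚ E ∣ finrank ℚ V := by
  obtain ⟨k, hk | hk⟩ := Int.even_or_odd' n
  · exact A.two_mul_finrank_dvd_finrank_of_isReal_of_piece_eq_bot hk hσ (h0 k hk)
  · exact A.two_mul_finrank_dvd_finrank_of_isReal ⟨k, hk⟩ hσ

include A in
/-- `E` TOTALLY REAL, `V^{w/2,w/2} = 0` ⟹ `2[E:ℚ] ∣ dim_ℚ V` («`F` is totally real … `[F:ℚ]` divides `n`»).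
[cite: Totaro2015HodgeStructuresN00N, §3 Thm. 3.1 (arXiv p0006)] -/
theorem two_mul_finrank_dvd_finrank_of_isTotallyReal_of_forall_piece_eq_bot [IsTotallyReal E]
    (h0 : ∀ k : ℤ, n = 2 * k → H.piece k k = ⊥) : 2 * finrank ℚ E ∣ finrank ℚ V := by
  obtain ⟨w⟩ : Nonempty (InfinitePlace E) := inferInstance
  exact A.two_mul_finrank_dvd_finrank_of_isReal_of_forall_piece_eq_bot h0 (InfinitePlace.isReal_iff.1 (IsTotallyReal.isReal w))

include A in
/-- `[E:ℚ]` ODD (so `E` has a real place), `V^{w/2,w/2} = 0` ⟹ `2[E:ℚ] ∣ dim_ℚ V`. [cite: Totaro2015HodgeStructuresN00N, §3 Thm. 3.1 (arXiv p0006)] -/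
theorem two_mul_finrank_dvd_finrank_of_odd_finrank_field_of_forall_piece_eq_bot (hodd : Odd (finrank ℚ E))
    (h0 : ∀ k : ℤ, n = 2 * k → H.piece k k = ⊥) : 2 * finrank ℚ E ∣ finrank ℚ V := by
  classical
  obtain ⟨w⟩ := Fintype.card_pos_iff.mp (InfinitePlace.nrRealPlaces_pos_of_odd_finrank hodd)
  exact A.two_mul_finrank_dvd_finrank_of_isReal_of_forall_piece_eq_bot h0 (InfinitePlace.isReal_iff.1 w.2)

include A in
/-- `dim_E V` ODD and `V^{w/2,w/2} = 0` ⟹ NO embedding of `E` is real (`E` is totally complex).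
[cite: Totaro2015HodgeStructuresN00N, §3 proof of Thm. 3.1 (arXiv p0007) «this number is even»] -/
theorem not_isReal_of_odd_finrank_div_of_forall_piece_eq_bot (h0 : ∀ k : ℤ, n = 2 * k → H.piece k k = ⊥)
    (hodd : Odd (finrank ℚ V / finrank ℚ E)) (σ : E →+* ℂ) : ¬ ComplexEmbedding.IsReal σ := by
  intro hσ
  obtain ⟨c, hc⟩ := A.two_mul_finrank_dvd_finrank_of_isReal_of_forall_piece_eq_bot h0 hσ
  have h : finrank ℚ V / finrank ℚ E = 2 * c := by
    rw [hc, mul_comm 2, mul_assoc, Nat.mul_div_cancel_left _ (Module.finrank_pos (R := ℚ) (M := E))]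
  exact (Nat.not_even_iff_odd.2 hodd) ⟨c, by rw [h, two_mul]⟩

include A in
/-- `dim_E V` odd, `V^{w/2,w/2} = 0` ⟹ `E` is totally complex. [cite: Totaro2015HodgeStructuresN00N, §3 proof of Thm. 3.1 (arXiv p0007)] -/
theorem isTotallyComplex_of_odd_finrank_div_of_forall_piece_eq_bot (h0 : ∀ k : ℤ, n = 2 * k → H.piece k k = ⊥)
    (hodd : Odd (finrank ℚ V / finrank ℚ E)) : IsTotallyComplex E :=
  ⟨fun w ↦ InfinitePlace.not_isReal_iff_isComplex.1 fun hw ↦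
    A.not_isReal_of_odd_finrank_div_of_forall_piece_eq_bot h0 hodd w.embedding (InfinitePlace.isReal_iff.1 hw)⟩

end EndAction

/-! ### The `E_φ`-level reading -/

section EndAlg

variable [Module.Finite ℚ V] {K : Type v} [Field K] [NumberField K]

/-- **Any number field `f : K → E_φ` of Hodge endomorphisms with a REAL place forces `2[K:ℚ] ∣ dim_ℚ V` once `V^{w/2,w/2} = 0`**
(either parity of `w`). [cite: Totaro2015HodgeStructuresN00N, §3 Thm. 3.1 and proof (arXiv p0006–p0007)] -/
theorem two_mul_finrank_dvd_finrank_of_ringHom_endAlg_of_isReal_of_forall_piece_eq_bot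
    (h0 : ∀ k : ℤ, n = 2 * k → H.piece k k = ⊥) (f : K →+* H.endAlg) {σ : K →+* ℂ} (hσ : ComplexEmbedding.IsReal σ) :
    2 * finrank ℚ K ∣ finrank ℚ V :=
  (EndAction.ofRingHom f).two_mul_finrank_dvd_finrank_of_isReal_of_forall_piece_eq_bot h0 hσ

/-- `E_φ ≅ K` totally real, `V^{w/2,w/2} = 0` ⟹ `2[E_φ:ℚ] ∣ dim_ℚ V`. [cite: Totaro2015HodgeStructuresN00N, §3 Thm. 3.1 (arXiv p0006)] -/
theorem two_mul_finrank_endAlg_dvd_finrank_of_ringEquiv_of_isTotallyReal_of_forall_piece_eq_bot [IsTotallyReal K]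
    (h0 : ∀ k : ℤ, n = 2 * k → H.piece k k = ⊥) (e : K ≃+* H.endAlg) : 2 * finrank ℚ H.endAlg ∣ finrank ℚ V := by
  have hK : finrank ℚ K = finrank ℚ H.endAlg :=
    (LinearEquiv.ofBijective e.toAddMonoidHom.toRatLinearMap e.bijective).finrank_eq
  rw [← hK]
  exact (EndAction.ofRingHom (e : K →+* H.endAlg)).two_mul_finrank_dvd_finrank_of_isTotallyReal_of_forall_piece_eq_bot h0

end EndAlg

/-! ## §4 With the index: a CENTRAL field on an irreducible structure, even weight, real place -/

section Index

variable [Module.Finite ℚ V]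

/-- **`dim_E V ≡ h^{m,m}_σ (mod 2d)`** for an IRREDUCIBLE `H` of even weight `2m`, `E` CENTRAL in `E_φ` with a real embedding `σ`, `d`
the index of `E_φ` (`dim_E V = 2·dim_ℂ(V_σ ∩ F^{m+1}) + h^{m,m}_σ` with `d ∣ dim_ℂ(V_σ ∩ F^{m+1})`).
[cite: Totaro2015HodgeStructuresN00N, §3 proof of Thm. 3.1 (arXiv p0007)] [cite: Zarhin2009EndomorphismsSuperellipticJacobians, §3 Lemma 3.7 (arXiv p0008)] -/
theorem IsIrreducible.finrank_div_modEq_finrank_eigenPiece_middle_of_central_of_isReal (hirr : H.IsIrreducible) {m : ℤ}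
    (hm : n = 2 * m) {d : ℕ} (hd : finrank ℚ H.endAlg = finrank ℚ (Subalgebra.center ℚ H.endAlg) * d ^ 2) (A : EndAction H E)
    (hcent : ∀ a : H.endAlg, ∀ e : E, (a : Module.End ℚ V) * A.ι e = A.ι e * a) {σ : E →+* ℂ}
    (hσ : ComplexEmbedding.IsReal σ) : finrank ℚ V / finrank ℚ E ≡ finrank ℂ (A.eigenPiece σ m m) [MOD 2 * d] := by
  obtain ⟨k, hk⟩ := hirr.index_dvd_finrank_iInf_eigenspace_inf_F_of_central hd A hcent σ (m + 1)
  unfold Nat.ModEq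
  rw [A.finrank_div_eq_two_mul_add_of_isReal hm hσ, hk, ← mul_assoc, Nat.add_mod, Nat.mul_mod_right, zero_add, Nat.mod_mod]

/-- **`V^{w/2,w/2} = 0` (either parity of `w`), `H` irreducible, `E` central with a real place ⟹ `2·d·[E:ℚ] ∣ dim_ℚ V`** (odd weight:
g48-#2's `two_mul_index_mul_finrank_dvd_finrank_of_central_of_isReal`). [cite: Totaro2015HodgeStructuresN00N, §3 Thm. 3.1 and proof (arXiv p0006–p0007)]
[cite: Zarhin2009EndomorphismsSuperellipticJacobians, §3 Lemma 3.7 (arXiv p0008)] -/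
theorem IsIrreducible.two_mul_index_mul_finrank_dvd_finrank_of_central_of_isReal_of_forall_piece_eq_bot (hirr : H.IsIrreducible)
    (h0 : ∀ k : ℤ, n = 2 * k → H.piece k k = ⊥) {d : ℕ}
    (hd : finrank ℚ H.endAlg = finrank ℚ (Subalgebra.center ℚ H.endAlg) * d ^ 2) (A : EndAction H E)
    (hcent : ∀ a : H.endAlg, ∀ e : E, (a : Module.End ℚ V) * A.ι e = A.ι e * a) {σ : E →+* ℂ}
    (hσ : ComplexEmbedding.IsReal σ) : 2 * d * finrank ℚ E ∣ finrank ℚ V := by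
  obtain ⟨m, hm | hm⟩ := Int.even_or_odd' n
  · obtain ⟨k, hk⟩ := hirr.index_dvd_finrank_iInf_eigenspace_inf_F_of_central hd A hcent σ (m + 1)
    refine ⟨k, ?_⟩
    rw [← A.two_mul_finrank_iInf_eigenspace_inf_F_mul_finrank_of_isReal_of_piece_eq_bot hm hσ (h0 m hm), hk]
    ring
  · exact hirr.two_mul_index_mul_finrank_dvd_finrank_of_central_of_isReal ⟨m, hm⟩ hd A hcent hσ

end Index

end Literature.AlgebraicGeometry.Motives.HodgeStructure

end
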